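import Literature.AnabelianGeometry.EtaleTheta.Discharge.Sec5OfThetaSetting
import Literature.AnabelianGeometry.EtaleTheta.Discharge.Sec5HfacOfPushforward
import Literature.AnabelianGeometry.EtaleTheta.Discharge.Sec5ConstEmbOfTerminal

/-!
# [EtTh] §5 AT THE §1 SETTING: Lemma 5.8's factorisation `hfac` ⟸ {Prop. 3.4 (ii), the definition of `D₀ → D^cnst`} and Def. 3.6 (iii)'s
# constants pulled back from the base curve, KNIT at abc-iut-L2-t4's `ofThetaSettingData` (pp. 298, 303, 322, 331 / PDF pp. 72, 77, 96, 105)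

Mochizuki, *The étale theta function and its Frobenioid-theoretic manifestations*, Publ. RIMS **45** (2009)
[cite: MochizukiEtTh2009, §5 p.322 (PDF p.96); Lem 5.8 p.331 (PDF p.105); §3 p.298 (PDF p.72)].  abc-iut cell, layer L2 (seat abc-iut-w4-d008,
gen 4; row «haug + hYdd PRODUCERS at the junction», abc-iut-L2-lead GO 2026-08-26T09:39:43Z).  PROOF-ONLY knit (0 definitions) of this
seat's files p431786 (`Sec5ConstEmbOfTerminal`) and p432786/p433787/p436167 (`hfac` ⟸ {`Prop34Cnst`, `e`, `hYdd`}) AT abc-iut-L2-t4's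
junction `ThetaFrobenioid.ofThetaSettingData μ hC hS …` (`Discharge/Sec5OfThetaSetting.lean`, p433549: `X := C.temperedArithmeticGroup e`,
`T := C.thetaEnvData μ hC hS`, `ιX := id`).  COMPANION of abc-iut-L2-t4's own knit `Discharge/Sec5OriginClausesOfThetaSetting.lean`
(`hΔcnst_ofThetaSettingData` / `hcnst_ofThetaSettingData` / `hconstΔ_ofThetaSettingData`, from this seat's `Sec5OriginClausesOfPushforward`
with the Π-side inputs discharged there) — this file adds the two items that knit does not carry:
* **`hfac_ofThetaSettingData_of_pushforward`** — the binder `hfac` of abc-iut-L2-d4's Thm. 5.7 / `Sec5Thm57Constants` files (GAP G-L2d4-1)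
  at the Setting ⟸ {`Prop34Cnst T₀ cnst`, `eι : tf.base ⋙ cnst ≅ aug_* ⋙ G`} ONLY — `hYdd` from the FIELD `E.DoubleUnderline.map_aug_Ydduu`
  («`Ÿ̲̲` geometrically connected over `K = K̈`», Prop. 2.2 (iii)), `haug` by abc-iut-L3's open mapping theorem `augIsOpenMap_holds`, and
  `eι` = print's DEFINITION «the natural functor `D₀ → D^cnst` determined by `Π^tp_X ↠ G_K` [cf. [FrdII], Example 1.3, (ii)]» (§3 p.298);
* **`facts_ofThetaSettingYddData_ofSubsingleton`** — abc-iut-L2-t4's `facts_ofThetaSettingYddData` (`Facts` ⟸ {`hconst`, `hgc`}) with Def. 3.6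
  (iii)'s `hconst` DISCHARGED for the constants pulled back from the base curve (`constEmb := B(t)^× ∘ c₀`, GAP G-L2t4-3,
  `TemperedFrobenioid.biratAutModel_unitsMap_comp_apply_of_subsingleton`): `Facts` ⟸ `hgc` (Lemma 5.8's geometric connectedness,
  G-L2t4-4) + the data `t, c₀` + injectivity of the composite.
HONEST FRAMING: kernel-checked knitting over the typed §1/§2 Setting and abc-iut-L2-t3's Def. 3.6 data; `tf` is NOT shown inhabited for the
curve; nothing of [EtTh] §5 is asserted; typed ≠ proved; no side taken on [IUTchIII] Cor. 3.12.
-/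

noncomputable section

namespace Literature.AnabelianGeometry.EtaleTheta

open CategoryTheory Opposite Literature.AlgebraicGeometry.Frobenioids Literature.AnabelianGeometry.SemiGraphs
  Literature.AnabelianGeometry.SemiGraphs.GaloisObjects Literature.AlgebraicGeometry.Frobenioids.QuasiTemperoid.BTempConnected

universe v₀ u₁ v₁

/-! ## `hYdd` at `Π^tp_X̲̲ = C.Huu` (private restatement; public producers: this seat's `DoubleUnderline.hYdd_ofHuu`,
`Sec5OriginInputsOfThetaSetting.lean` p436545, and abc-iut-L2-t4's `hYdd_ofThetaSetting`, `Sec5OriginClausesOfThetaSetting.lean`) -/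

namespace ThetaSetting.EtaleThetaData.DoubleUnderline

variable {p : ℕ} [Fact p.Prime] {D : ThetaSetting p} {E : D.EtaleThetaData} {l : ℕ} (C : E.DoubleUnderline l)
  (e : D.toTemperedCurve.GroupLevelData)

/-- Elements of `Π^tp_X̲̲` with the same image under `D.aug` have the same augmentation in the Ex. 3.10 datum (`augK = galEquiv ∘ augGK`).
[cite: MochizukiSemiAnbd2006, Ex 3.10 p.43] -/
private theorem aug_tag_eq_of_aug_eq {k y : C.Huu} (h : D.aug.toMonoidHom (k : D.PiTemp) = D.aug.toMonoidHom (y : D.PiTemp)) :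
    (C.temperedArithmeticGroup e).aug k = (C.temperedArithmeticGroup e).aug y := by
  have hGK : D.toTemperedCurve.augGK (k : D.PiTemp) = D.toTemperedCurve.augGK (y : D.PiTemp) := Subtype.ext h
  change e.galEquiv (D.toTemperedCurve.augGK (k : D.PiTemp)) = e.galEquiv (D.toTemperedCurve.augGK (y : D.PiTemp))
  rw [hGK]

/-- `hYdd` at the junction: every `y ∈ Π^tp_X̲̲` has the augmentation of some `k ∈ Π^tp_Ÿ̲̲` (FIELD `map_aug_Ydduu`: `Ÿ̲̲` geometrically connected
over `K = K̈`).  [cite: MochizukiEtTh2009, Prop 2.2 (iii) p.263 (PDF p.37)] -/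
private theorem hYdd_tag :
    ∀ y : C.Huu, ∃ k ∈ D.GtpYdd.subgroupOf C.Huu, (C.temperedArithmeticGroup e).aug k = (C.temperedArithmeticGroup e).aug y := by
  intro y
  have hy : D.aug.toMonoidHom (y : D.PiTemp) ∈ (D.GtpYdd ⊓ C.Huu).map D.aug.toMonoidHom := by
    rw [C.map_aug_Ydduu]
    exact D.aug_mem_GK (y : D.PiTemp)
  obtain ⟨k, ⟨hkY, hkH⟩, hk⟩ := hy
  exact ⟨⟨k, hkH⟩, Subgroup.mem_subgroupOf.mpr hkY, C.aug_tag_eq_of_aug_eq e hk⟩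

end ThetaSetting.EtaleThetaData.DoubleUnderline

/-! ## At `ofThetaSettingData` (general `A_⊙`) -/

namespace ThetaFrobenioid

section General

variable {p : ℕ} [Fact p.Prime] {D : ThetaSetting p} {E : D.EtaleThetaData} {l : ℕ} {C : E.DoubleUnderline l}
  {e : D.toTemperedCurve.GroupLevelData} {N : ℕ+} (μ : D.CyclotomeMod l N) (hC : D.Compat) (hS : D.Sec2Hyps)
  {D₀ : Type} [Category.{v₀} D₀] {V : FrdIMonoidStub.{0}} {T₀ : RealifiedDivisorMonoids (D₀ := D₀) V}
  {VD : FrdICatStub.{1, 0, 0} (ConnectedPart (BTemp (C.temperedArithmeticGroup e).Pi))}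
  {tf : TemperedFrobenioid T₀ (ConnectedPart (BTemp (C.temperedArithmeticGroup e).Pi)) VD} {hZ : tf.monoidType = MonoidType.Z}
  {hP : ∀ A : (ConnectedPart (BTemp (C.temperedArithmeticGroup e).Pi))ᵒᵖ, IsPerfect (tf.Φ.carrier A)}
  {NH : Subgroup (Field.absoluteGaloisGroup D.K) → tf.category → ℕ+ → Prop} {A₀ : tf.category}
  {hA₀ : PreFrobenioid.IsFrobeniusTrivial tf.toElem A₀} {hA₀' : SemiGraphs.IsGaloisObj A₀.base.obj}
  {pullFrac : ∀ {A A' : (BiKummerSetting.mkOfConnectedTemperoid (C.temperedArithmeticGroup e) tf hZ hP NH A₀ hA₀ hA₀').C} (_ : A' ⟶ A),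
    (BiKummerSetting.mkOfConnectedTemperoid (C.temperedArithmeticGroup e) tf hZ hP NH A₀ hA₀ hA₀').biratUnits A →
      (BiKummerSetting.mkOfConnectedTemperoid (C.temperedArithmeticGroup e) tf hZ hP NH A₀ hA₀ hA₀').biratUnits A'}
  {θ : (BiKummerSetting.mkOfConnectedTemperoid (C.temperedArithmeticGroup e) tf hZ hP NH A₀ hA₀ hA₀').biratUnits
    (BiKummerSetting.mkOfConnectedTemperoid (C.temperedArithmeticGroup e) tf hZ hP NH A₀ hA₀ hA₀').Aodot}
  {Bl : (BiKummerSetting.mkOfConnectedTemperoid (C.temperedArithmeticGroup e) tf hZ hP NH A₀ hA₀ hA₀').C}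
  {Pl : (BiKummerSetting.mkOfConnectedTemperoid (C.temperedArithmeticGroup e) tf hZ hP NH A₀ hA₀ hA₀').FractionPair θ Bl}
  {Rl : (BiKummerSetting.mkOfConnectedTemperoid (C.temperedArithmeticGroup e) tf hZ hP NH A₀ hA₀ hA₀').NthRoot θ Pl C.lPNat pullFrac}
  (h : ModelFrobenioid.Hypotheses tf.divisorMonoid tf.ratFnFunctor)
  (Q : FrobenioidTheta.ThetaSubquotientStub.{0} (ConnectedPart (BTemp (C.temperedArithmeticGroup e).Pi)))
  (R : (BiKummerSetting.mkOfConnectedTemperoid (C.temperedArithmeticGroup e) tf hZ hP NH A₀ hA₀ hA₀').NthRoot Rl.root Rl.pair N pullFrac)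
  (K' : Type) [Field K'] (constEmb : K'ˣ →* tf.biratUnitsModel R.BN) (constEmb_injective : Function.Injective constEmb)

variable
  (hinvc : ∀ g : Aut R.AN.base,
    pull tf.divisorMonoid g.hom (ModelFrobenioid.div R.pair.num) = ModelFrobenioid.div R.pair.num)
  (hinvp : ∀ y : (C.thetaEnvData μ hC hS).PiX, y ∈ (C.thetaEnvData μ hC hS).PiYdd →
    pull tf.divisorMonoid ((BiKummerSetting.mkOfConnectedTemperoid (C.temperedArithmeticGroup e) tf hZ hP NH A₀ hA₀ hA₀').galoisSurj
      R.AN.base R.αData.isGalois ((ContinuousMulEquiv.refl _) y)).hom (ModelFrobenioid.div R.pair.den) = ModelFrobenioid.div R.pair.den)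
  {Dcnst : Type u₁} [Category.{v₁} Dcnst] (cnst : D₀ ⥤ Dcnst)
  (G : ConnectedPart (BTemp (Field.absoluteGaloisGroup D.K)) ⥤ Dcnst)
  (eι : tf.base ⋙ cnst ≅ QuasiTemperoid.pushforward (C.temperedArithmeticGroup e).aug.toMonoidHom
    (C.temperedArithmeticGroup e).aug_surjective (C.temperedArithmeticGroup e).augIsOpenMap_holds ⋙ G)

include h eι in
/-- **GAP G-L2d4-1's `hfac` AT THE §1 SETTING ⟸ {`Prop34Cnst`, `eι`}**: every `y ∈ Im(Π^tp_Y̲̲)` acts on `O^×(B_N)` through `s^⊓-gp_N` like some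
`h ∈ H_{B_N} = Im(Π^tp_Ÿ̲̲)` (Lemma 5.8 proof p.331 «`Π^tp_Y` [i.e., `G_K` …] acts») — `hfac_ofConnectedTemperoidData_of_pushforward` with
`hYdd` from the FIELD `map_aug_Ydduu` (`Ÿ̲̲` geometrically connected over `K = K̈`) and `haug` by abc-iut-L3's open mapping theorem.
[cite: MochizukiEtTh2009, Lem 5.8 p.331 (PDF p.105); Prop 2.2 (iii) p.263 (PDF p.37); §3 p.298 (PDF p.72)] -/
theorem hfac_ofThetaSettingData_of_pushforward (hP34 : RealifiedDivisorMonoids.Prop34Cnst T₀ cnst) :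
    ∀ y ∈ (ofThetaSettingData μ hC hS h Q R K' constEmb constEmb_injective hinvc hinvp).imPiY,
      ∃ k ∈ (ofThetaSettingData μ hC hS h Q R K' constEmb constEmb_injective hinvc hinvp).HB,
        ∀ u ∈ (ofThetaSettingData μ hC hS h Q R K' constEmb constEmb_injective hinvc hinvp).units
            (ofThetaSettingData μ hC hS h Q R K' constEmb constEmb_injective hinvc hinvp).BN,
          (ofThetaSettingData μ hC hS h Q R K' constEmb constEmb_injective hinvc hinvp).sgpCap y * u *
              ((ofThetaSettingData μ hC hS h Q R K' constEmb constEmb_injective hinvc hinvp).sgpCap y)⁻¹ =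
            (ofThetaSettingData μ hC hS h Q R K' constEmb constEmb_injective hinvc hinvp).sgpCap k * u *
              ((ofThetaSettingData μ hC hS h Q R K' constEmb constEmb_injective hinvc hinvp).sgpCap k)⁻¹ :=
  hfac_ofConnectedTemperoidData_of_pushforward (T := C.thetaEnvData μ hC hS) h Q C.odd_lPNat R (ContinuousMulEquiv.refl _) K'
    constEmb constEmb_injective hinvc hinvp cnst G eι hP34 (C.hYdd_tag e)

end General

end ThetaFrobenioid

/-! ## At `ofThetaSettingData` over `mkOfThetaSettingYdd` (`A_⊙^bs := Ÿ̲̲`): `Facts` from `hgc` alone with the constants of the base curve -/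

namespace ThetaFrobenioid

variable {p : ℕ} [Fact p.Prime] {D : ThetaSetting p} {E : D.EtaleThetaData} {l : ℕ} {C : E.DoubleUnderline l}
  {e : D.toTemperedCurve.GroupLevelData} {N : ℕ+} (μ : D.CyclotomeMod l N) (hC : D.Compat) (hS : D.Sec2Hyps)
  {D₀ : Type} [Category.{v₀} D₀] {V : FrdIMonoidStub.{0}} {T₀ : RealifiedDivisorMonoids (D₀ := D₀) V}
  {VD : FrdICatStub.{1, 0, 0} (ConnectedPart (BTemp (C.temperedArithmeticGroup e).Pi))}
  {tf : TemperedFrobenioid T₀ (ConnectedPart (BTemp (C.temperedArithmeticGroup e).Pi)) VD} {hZ : tf.monoidType = MonoidType.Z}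
  {hP : ∀ A : (ConnectedPart (BTemp (C.temperedArithmeticGroup e).Pi))ᵒᵖ, IsPerfect (tf.Φ.carrier A)}
  {NH : Subgroup (Field.absoluteGaloisGroup D.K) → tf.category → ℕ+ → Prop}
  {pullFrac : ∀ {A A' : (BiKummerSetting.mkOfThetaSettingYdd C e μ hC hS tf hZ hP NH).C} (_ : A' ⟶ A),
    (BiKummerSetting.mkOfThetaSettingYdd C e μ hC hS tf hZ hP NH).biratUnits A →
      (BiKummerSetting.mkOfThetaSettingYdd C e μ hC hS tf hZ hP NH).biratUnits A'}
  {θ : (BiKummerSetting.mkOfThetaSettingYdd C e μ hC hS tf hZ hP NH).biratUnits (BiKummerSetting.mkOfThetaSettingYdd C e μ hC hS tf hZ hP NH).Aodot}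
  {Bl : (BiKummerSetting.mkOfThetaSettingYdd C e μ hC hS tf hZ hP NH).C}
  {Pl : (BiKummerSetting.mkOfThetaSettingYdd C e μ hC hS tf hZ hP NH).FractionPair θ Bl}
  {Rl : (BiKummerSetting.mkOfThetaSettingYdd C e μ hC hS tf hZ hP NH).NthRoot θ Pl C.lPNat pullFrac}
  (h : ModelFrobenioid.Hypotheses tf.divisorMonoid tf.ratFnFunctor)
  (Q : FrobenioidTheta.ThetaSubquotientStub.{0} (ConnectedPart (BTemp (C.temperedArithmeticGroup e).Pi)))
  (R : (BiKummerSetting.mkOfThetaSettingYdd C e μ hC hS tf hZ hP NH).NthRoot Rl.root Rl.pair N pullFrac)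
  (K' : Type) [Field K'] {X₀ : ConnectedPart (BTemp (C.temperedArithmeticGroup e).Pi)} [Subsingleton (R.BN.base ⟶ X₀)]
  (t : R.BN.base ⟶ X₀) (c₀ : K'ˣ →* (tf.ratFnFunctor.obj (op X₀))ˣ)
  (hinj : Function.Injective ((Units.map (tf.ratFnFunctor.map t.op).hom).comp c₀))
  (hinvc : ∀ g : Aut R.AN.base,
    pull tf.divisorMonoid g.hom (ModelFrobenioid.div R.pair.num) = ModelFrobenioid.div R.pair.num)
  (hinvp : ∀ y : (C.thetaEnvData μ hC hS).PiX, y ∈ (C.thetaEnvData μ hC hS).PiYdd →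
    pull tf.divisorMonoid ((BiKummerSetting.mkOfThetaSettingYdd C e μ hC hS tf hZ hP NH).galoisSurj
      R.AN.base R.αData.isGalois ((ContinuousMulEquiv.refl _) y)).hom (ModelFrobenioid.div R.pair.den) = ModelFrobenioid.div R.pair.den)

/-- **`Facts` for the §5 data of the Setting with `A_⊙^bs := Ÿ̲̲` and the constants PULLED BACK FROM THE BASE CURVE** (`constEmb := B(t)^× ∘ c₀`
through an arrow `t : B_N^bs → X₀` into an object receiving at most one arrow from `B_N^bs` — the curve as the one-point object,
`ConnectedPunit.subsingleton_hom`): abc-iut-L2-t4's `facts_ofThetaSettingYddData` with Def. 3.6 (iii)'s `hconst` DISCHARGED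
(`TemperedFrobenioid.biratAutModel_unitsMap_comp_apply_of_subsingleton`, GAP G-L2t4-3) — `Facts` from `hgc` (Lemma 5.8's geometric
connectedness) ALONE.  [cite: MochizukiEtTh2009, §5 p.330–331 (PDF pp.104–105); Def 3.6 (iii) p.303 (PDF p.77); Lem 5.8 p.331 (PDF p.105)] -/
theorem facts_ofThetaSettingYddData_ofSubsingleton
    (hgc : ∀ u : (ofThetaSettingData μ hC hS h Q R K' ((Units.map (tf.ratFnFunctor.map t.op).hom).comp c₀) hinj hinvc hinvp).units
        (ofThetaSettingData μ hC hS h Q R K' ((Units.map (tf.ratFnFunctor.map t.op).hom).comp c₀) hinj hinvc hinvp).BN,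
      (∀ y ∈ (ofThetaSettingData μ hC hS h Q R K' ((Units.map (tf.ratFnFunctor.map t.op).hom).comp c₀) hinj hinvc hinvp).imPiY,
        (ofThetaSettingData μ hC hS h Q R K' ((Units.map (tf.ratFnFunctor.map t.op).hom).comp c₀) hinj hinvc hinvp).sgpCap y *
          (u : Aut (ofThetaSettingData μ hC hS h Q R K' ((Units.map (tf.ratFnFunctor.map t.op).hom).comp c₀) hinj hinvc hinvp).BN) *
          ((ofThetaSettingData μ hC hS h Q R K' ((Units.map (tf.ratFnFunctor.map t.op).hom).comp c₀) hinj hinvc hinvp).sgpCap y)⁻¹ =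
            u) →
      (ofThetaSettingData μ hC hS h Q R K' ((Units.map (tf.ratFnFunctor.map t.op).hom).comp c₀) hinj hinvc hinvp).unitsToBirat
          (ofThetaSettingData μ hC hS h Q R K' ((Units.map (tf.ratFnFunctor.map t.op).hom).comp c₀) hinj hinvc hinvp).BN u ∈
        (ofThetaSettingData μ hC hS h Q R K' ((Units.map (tf.ratFnFunctor.map t.op).hom).comp c₀) hinj hinvc hinvp).constEmb.range) :
    (ofThetaSettingData μ hC hS h Q R K' ((Units.map (tf.ratFnFunctor.map t.op).hom).comp c₀) hinj hinvc hinvp).Facts :=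
  facts_ofThetaSettingYddData μ hC hS h Q R K' _ hinj hinvc hinvp
    (tf.biratAutModel_unitsMap_comp_apply_of_subsingleton R.BN t c₀) hgc

end ThetaFrobenioid

end Literature.AnabelianGeometry.EtaleTheta

end
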